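import Summits.QuantumFields.BalabanUV.Beta.StepResidualBorder
import Literature.MathematicalPhysics.QuantumFieldTheory.Balaban1983to89.Beta.ResolventCompositionStepB

/-!
# (J2), FIELD–MULTIPLIER BLOCK: the step residual `bhKStep (j+1) ∘ KInvStep Lc (j+1)` has a VANISHING field–multiplier block —
# the value Hessian `wΦ_M` applied to the block averages `𝒬_M ℋ_N` of the fine minimiser IS the coarse pull-back `𝒬_{Lc}ᵀ Φ^ℋ_N`
# of the fine multiplier (β sub-cell, row BETA-an2 = BINDER-OWNERS row D1, gen 15; leaf L1.c-fm of `gen15/SKELETON-D1-hR.v2.md`)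

HONEST FRAMING (cell charter, verbatim): «discharging BetaPertH makes Balaban's UV stability UNCONDITIONAL — a real
constructive-QFT result; it is NOT the continuum limit and NOT the Clay problem.»  DERIVED cell leaf (pub-balaban β sub-cell, lane
an2 gen 15); no statement of Bałaban's papers is typed here, no `[cite:]` tag, no `Prop` fact; it instantiates no binder of the
β-function wall by itself.  It proves the (fm) block of the step residual (J2); the (ff) block (`= 1 + gauge`) and the absorption (J3)
remain OPEN leaves.  NOT `BetaPertH`; NOT continuum; NOT Clay.

## The mechanism (`M := Lc^{j+1}`, `N := Lc^{j+2} = M·Lc`; [folklore] throughout)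

an5's TWO-LEVEL REPRODUCTION `ResolventComposition.wH_reproduction` says `ℋ_N(·; m, z′) = Σ_{(l″,w′)} c(l″,w′)·ℋ_M(·; l″,w′)` with
`c := 𝒬_M ℋ_N(·; m, z′)` (pointwise absolutely convergent).  Apply `d*d` (a finite stencil: `KernelSpecInstance.hasSum_curv`/`hasSum_curvAdj`)
and the gauge-free Euler–Lagrange identities `d*d ℋ = 𝒬ᵀ Φ^ℋ` at BOTH levels (`curvAdj_curv_Hcol` ⇐ an5's `wM_eq_zero`):
`𝒬_Nᵀ Φ^ℋ_N(·; m, z′) = 𝒬_Mᵀ [wΦ_M ⋆ c]` as fine 1-forms (§3).  The ADJOINT SEMIGROUP LAW `𝒬_Nᵀ = 𝒬_Mᵀ ∘ 𝒬_{Lc}ᵀ` (§1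
`contourSumAdj_mul`, from `contourSum_mul` by the adjointness `lip1_contourSumAdj` against indicators) and the INJECTIVITY of `𝒬_Mᵀ` on
bounded coarse forms (§2 `eq_of_contourSumAdj_eq`: pair with the summable minimiser columns `ℋ_M(·; κ, x)`, whose block-contour sums are
the indicators, `contourSum_Hcol`) give the STEP-LATTICE identity §4 **`tsum_contourSum_Hcol_mul_wΦ : wΦ_M ⋆ (𝒬_M ℋ_N) = 𝒬_{Lc}ᵀ Φ^ℋ_N`**.
Read through the action lemma `BorderedHessianStepStraight.comp_bhKStep_succ_inl` and the column lemmas of `StepResidualBorder` (the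
`(inl, inr)` column of `KInvStep` is `M^{−(d+2)}·c`, its `(inr, inr)` block at coarse points is `Φ^ℋ_N`, `KInvStep_inr_inr_coarse`), the two
summands of the (fm) entry are `M^{d+2}·(wΦ_M ⋆ c)` and `−M^{d+2}·𝒬_{Lc}ᵀ Φ^ℋ_N`: §5 **`comp_bhKStep_KInvStep_inl_inr = 0`**.
At `j = 0` (`M = 1`) this is `BorderedHessianResidual.resid_inl_inr = 0`.  All declarations `[folklore]`; axioms standard.  Provenance:
b2b-balaban β sub-cell, unit beta-an2 gen 15, 2026-08-20 (v1); over `StepResidualBorder`, `BorderedHessianStepStraight` (p206693),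
`ResolventComposition` / `ResolventCompositionStepB` (an5), `KKTFluctuationEnergy`, `KernelSpecInstance` BY NAME; no existing file touched.
-/

open Finset
open scoped BigOperators
open Literature.Probability.LatticeModels (TorusSite Torus.proj Torus.proj_apply)
open Literature.MathematicalPhysics.QuantumFieldTheory
open Literature.MathematicalPhysics.QuantumFieldTheory.Balaban1983to89
open Literature.MathematicalPhysics.QuantumFieldTheory.Balaban1983to89.Beta
open B12Sec2to5 (l1 l1_nonneg Decay510)
open ExpKernelCalculus (MKer Decays comp)
open AffineAveraging (Form0 Form1 Form2 box toSite unitVec unitVec_apply dz curv curvAdj codiff₁ contourSum)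
open AffineReproduction (contourSumAdj)
open KKTFluctuationKernel (delta1 delta1_apply Gam)
open KKTFluctuationEnergy (lip0 lip1 lip1_contourSumAdj abs_contourSumAdj_le summable_mul_of_bdd summable_mul_of_bdd' contourSumAdj_eq)
open KKTFluctuationUnique (abs_le_of_decay510)
open DecimatedMomentLimit (summable_of_decay510)
open KernelSpecInstance (wH wΦ decay_wΦ opEL hasSum_curv hasSum_curvAdj op₁₁_superpos)
open LatticeForm (quo)
open OneStepResolventKernel (Fib KInv KInv_inr_inr_coarse quo_zsmul eq_zsmul_quo_of_proj proj_zsmul)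
open OneStepKernelFamily (KInvStep dec legSet legW legPt LegIdx)
open ResolventComposition (Hcol Hcol_apply HΦcol HΦcol_apply contourSum_Hcol curvAdj_curv_Hcol Hcol_bdd_summable HΦcol_bdd
  KInvStep_inl_inr contourSum_mul wH_reproduction summable_wH_sub_zsmul zsmul_pow_succ exists_abs_KInvStep_le)
open ResolventCompositionStepB (abs_contourSum_le)
open BalabanCompositeJets (summable_contourSum)
open BalabanStepJetsSucc (E2 wVH)
open Summit.QuantumFields.BalabanUV.Beta.TameKernelCalculus
open Summit.QuantumFields.BalabanUV.Beta.AxialDressingRooted (KInvStep_inr_off' one_le_of_neZero)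

namespace Summit.QuantumFields.BalabanUV.Beta.BorderedHessian

noncomputable section

variable {d : ℕ}

/-! ## §1 The adjoint semigroup law of block-contour sums (pairing with indicators: `BorderedHessianSymmetry.lip1_delta1_left`) -/

/-- [folklore] **THE ADJOINT SEMIGROUP LAW OF BLOCK-CONTOUR SUMS**: `𝒬_{ML}ᵀ = 𝒬_Mᵀ ∘ 𝒬_Lᵀ` on bounded coarse 1-forms — the adjoint of
`ResolventComposition.contourSum_mul` (`𝒬_{ML} = 𝒬_L ∘ 𝒬_M`), obtained by pairing with bond indicators (`lip1_contourSumAdj`). -/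
theorem contourSumAdj_mul (M L : ℕ) [NeZero M] [NeZero L] {φ : Form1 (d + 1) ℝ} {C : ℝ} (hφ : ∀ κ y, |φ κ y| ≤ C) :
    contourSumAdj (M * L) φ = contourSumAdj M (contourSumAdj L φ) := by
  haveI : NeZero (M * L) := ⟨mul_ne_zero (NeZero.ne M) (NeZero.ne L)⟩
  have hM : 0 < M := Nat.pos_of_ne_zero (NeZero.ne M)
  funext κ x
  have hδ : ∀ μ, Summable (delta1 κ x μ) := summable_delta1 κ x
  have hQδ : ∀ μ, Summable (contourSum M (delta1 κ x) μ) := fun μ => summable_contourSum M hδ μ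
  have hφ' : ∀ κ y, |contourSumAdj L φ κ y| ≤ L * C := fun κ y => abs_contourSumAdj_le hφ κ y
  calc contourSumAdj (M * L) φ κ x
      = lip1 (delta1 κ x) (contourSumAdj (M * L) φ) := (lip1_delta1_left κ x _).symm
    _ = ∑' y, ∑ μ, φ μ y * contourSum (M * L) (delta1 κ x) μ y := lip1_contourSumAdj (N := M * L) hδ hφ
    _ = ∑' y, ∑ μ, φ μ y * contourSum L (contourSum M (delta1 κ x)) μ y := by rw [contourSum_mul M L hM]
    _ = lip1 (contourSum M (delta1 κ x)) (contourSumAdj L φ) := (lip1_contourSumAdj (N := L) hQδ hφ).symm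
    _ = ∑' y, ∑ μ, contourSumAdj L φ μ y * contourSum M (delta1 κ x) μ y := by
        unfold KKTFluctuationEnergy.lip1
        exact tsum_congr fun y => Finset.sum_congr rfl fun μ _ => mul_comm _ _
    _ = lip1 (delta1 κ x) (contourSumAdj M (contourSumAdj L φ)) := (lip1_contourSumAdj (N := M) hδ hφ').symm
    _ = contourSumAdj M (contourSumAdj L φ) κ x := lip1_delta1_left κ x _

/-! ## §2 `𝒬_Mᵀ` is injective on bounded coarse 1-forms -/

section Injective

variable {M : ℕ} [NeZero M]

/-- [folklore] **EVALUATION THROUGH THE MINIMISER COLUMN**: a bounded coarse 1-form is read off its pull-back `𝒬_Mᵀ ψ` by pairing with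
`ℋ_M(·; κ, x)` (`𝒬_M ℋ_M(·; κ, x) = δ_{(κ,x)}`): `ψ_κ(x) = ⟨ℋ_M(·; κ, x), 𝒬_Mᵀ ψ⟩`. -/
theorem eq_lip1_Hcol_contourSumAdj {ψ : Form1 (d + 1) ℝ} {C : ℝ} (hψ : ∀ κ y, |ψ κ y| ≤ C) (κ : Fin (d + 1))
    (x : Fin (d + 1) → ℤ) : ψ κ x = lip1 (Hcol (N := M) κ x) (contourSumAdj M ψ) := by
  obtain ⟨CH, -, -, hHs⟩ := Hcol_bdd_summable (N := M) (d := d)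
  rw [lip1_contourSumAdj (N := M) (hHs κ x) hψ]
  have e : ∀ y μ, ψ μ y * contourSum M (Hcol (N := M) κ x) μ y = if μ = κ ∧ y = x then ψ κ x else 0 := by
    intro y μ
    rw [contourSum_Hcol]
    by_cases h : μ = κ ∧ y = x
    · obtain ⟨rfl, rfl⟩ := h
      rw [if_pos ⟨rfl, rfl⟩, if_pos ⟨rfl, rfl⟩, mul_one]
    · rw [if_neg (fun h' => h ⟨h'.2, h'.1⟩), if_neg h, mul_zero]
  simp_rw [e]
  rw [tsum_eq_single x (fun y hy => Finset.sum_eq_zero fun μ _ => if_neg (fun h => hy h.2)),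
    Finset.sum_eq_single κ (fun μ _ hμ => if_neg (fun h => hμ h.1)) (fun h => (h (Finset.mem_univ κ)).elim),
    if_pos ⟨rfl, rfl⟩]

/-- [folklore] **`𝒬_Mᵀ` IS INJECTIVE ON BOUNDED COARSE 1-FORMS.** -/
theorem eq_of_contourSumAdj_eq {ψ₁ ψ₂ : Form1 (d + 1) ℝ} {C₁ C₂ : ℝ} (h₁ : ∀ κ y, |ψ₁ κ y| ≤ C₁) (h₂ : ∀ κ y, |ψ₂ κ y| ≤ C₂)
    (h : contourSumAdj M ψ₁ = contourSumAdj M ψ₂) : ψ₁ = ψ₂ := by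
  funext κ x
  rw [eq_lip1_Hcol_contourSumAdj (M := M) h₁ κ x, eq_lip1_Hcol_contourSumAdj (M := M) h₂ κ x, h]

end Injective

/-! ## §3 The two-level reproduction, differentiated: `𝒬_Nᵀ Φ^ℋ_N = 𝒬_Mᵀ [wΦ_M ⋆ 𝒬_M ℋ_N]` pointwise -/

section Reproduction

variable {N M L : ℕ} [NeZero N] [NeZero M] [NeZero L]

/-- [folklore] an5's two-level reproduction `wH_reproduction` as a pointwise `HasSum` of 1-forms:
`ℋ_N(·; m, z′) = Σ_{w′} Σ_{l″} (𝒬_M ℋ_N(·; m, z′))(l″, w′) · ℋ_M(·; l″, w′)`. -/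
theorem hasSum_reproduction (hN : N = M * L) (m : Fin (d + 1)) (z' : Fin (d + 1) → ℤ) (κ : Fin (d + 1)) (x : Fin (d + 1) → ℤ) :
    HasSum (fun w' : Fin (d + 1) → ℤ => ∑ l'' : Fin (d + 1),
        Hcol (N := M) l'' w' κ x * contourSum M (Hcol (N := N) m z') l'' w') (Hcol (N := N) m z' κ x) := by
  obtain ⟨CH, -, hHb, -⟩ := Hcol_bdd_summable (N := N) (d := d)
  have hc : ∀ l w, |contourSum M (Hcol (N := N) m z') l w| ≤ (box (d + 1) M).card * (M * CH) :=
    fun l w => abs_contourSum_le (hHb m z') l w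
  have hs : Summable (fun w' : Fin (d + 1) → ℤ => ∑ l'' : Fin (d + 1),
      contourSum M (Hcol (N := N) m z') l'' w' * wH (N := M) κ l'' (x - (M : ℤ) • w')) :=
    summable_sum fun l'' _ => summable_mul_of_bdd (fun w' => hc l'' w') (summable_wH_sub_zsmul M κ l'' x)
  have h := hs.hasSum
  rw [← wH_reproduction hN m z' κ x, ← Hcol_apply] at h
  have e : (fun w' : Fin (d + 1) → ℤ => ∑ l'' : Fin (d + 1), Hcol (N := M) l'' w' κ x * contourSum M (Hcol (N := N) m z') l'' w') =
      fun w' => ∑ l'' : Fin (d + 1), contourSum M (Hcol (N := N) m z') l'' w' * wH (N := M) κ l'' (x - (M : ℤ) • w') := by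
    funext w'
    exact Finset.sum_congr rfl fun l'' _ => by rw [Hcol_apply, mul_comm]
  rw [e]
  exact h

/-- [folklore] **THE REPRODUCTION DIFFERENTIATED**: applying the finite stencil `d*d` termwise (`hasSum_curv`, `hasSum_curvAdj`) and the
gauge-free Euler–Lagrange identities `d*d ℋ = 𝒬ᵀ Φ^ℋ` at both levels (`curvAdj_curv_Hcol`):
`HasSum (w′ ↦ Σ_{l″} c(l″,w′)·(𝒬_Mᵀ Φ^ℋ_M(·; l″,w′))_μ(y)) ((𝒬_Nᵀ Φ^ℋ_N(·; m, z′))_μ(y))`, `c = 𝒬_M ℋ_N(·; m, z′)`. -/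
theorem hasSum_reproduction_EL (hN : N = M * L) (m : Fin (d + 1)) (z' : Fin (d + 1) → ℤ) (μ : Fin (d + 1)) (y : Fin (d + 1) → ℤ) :
    HasSum (fun w' : Fin (d + 1) → ℤ => ∑ l'' : Fin (d + 1),
        contourSum M (Hcol (N := N) m z') l'' w' * contourSumAdj M (HΦcol (N := M) l'' w') μ y)
      (contourSumAdj N (HΦcol (N := N) m z') μ y) := by
  have h0 : ∀ κ x, HasSum (fun w' : Fin (d + 1) → ℤ => (fun κ x => ∑ l'' : Fin (d + 1),
      Hcol (N := M) l'' w' κ x * contourSum M (Hcol (N := N) m z') l'' w') κ x) (Hcol (N := N) m z' κ x) :=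
    fun κ x => hasSum_reproduction hN m z' κ x
  have h1 := hasSum_curv h0
  have h2 := hasSum_curvAdj h1 μ y
  rw [curvAdj_curv_Hcol] at h2
  have e : ∀ w' : Fin (d + 1) → ℤ, curvAdj (curv (fun κ x => ∑ l'' : Fin (d + 1),
      Hcol (N := M) l'' w' κ x * contourSum M (Hcol (N := N) m z') l'' w')) μ y =
      ∑ l'' : Fin (d + 1), contourSum M (Hcol (N := N) m z') l'' w' * contourSumAdj M (HΦcol (N := M) l'' w') μ y := by
    intro w'
    have h := op₁₁_superpos opEL (fun l'' => Hcol (N := M) l'' w') (fun l'' => contourSum M (Hcol (N := N) m z') l'' w') μ y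
    rw [show opEL (fun κ z => ∑ l'' : Fin (d + 1), Hcol (N := M) l'' w' κ z * contourSum M (Hcol (N := N) m z') l'' w') =
      curvAdj (curv (fun κ x => ∑ l'' : Fin (d + 1), Hcol (N := M) l'' w' κ x * contourSum M (Hcol (N := N) m z') l'' w')) from rfl] at h
    rw [h]
    exact Finset.sum_congr rfl fun l'' _ => by
      rw [show opEL (Hcol (N := M) l'' w') = curvAdj (curv (Hcol (N := M) l'' w')) from rfl, curvAdj_curv_Hcol]
  simp_rw [e] at h2
  exact h2

end Reproduction

/-! ## §4 The step-lattice identity `wΦ_M ⋆ (𝒬_M ℋ_N) = 𝒬_Lᵀ Φ^ℋ_N` -/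

section StepIdentity

variable {N M L : ℕ} [NeZero N] [NeZero M] [NeZero L]

/-- [folklore] **THE VALUE HESSIAN APPLIED TO THE BLOCK AVERAGES OF THE FINE MINIMISER IS THE COARSE PULL-BACK OF ITS MULTIPLIER**:
for `N = M·L` and every source `(m, z′)`,
`Σ′_{w′} Σ_{l″} (𝒬_M ℋ_N(·; m, z′))(l″, w′) · wΦ_M κ l″ (x − w′) = (𝒬_Lᵀ Φ^ℋ_N(·; m, z′))_κ(x)` on the whole `M`-step lattice. -/
theorem tsum_contourSum_Hcol_mul_wΦ (hN : N = M * L) (m : Fin (d + 1)) (z' : Fin (d + 1) → ℤ) (κ : Fin (d + 1))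
    (x : Fin (d + 1) → ℤ) :
    ∑' w' : Fin (d + 1) → ℤ, ∑ l'' : Fin (d + 1), contourSum M (Hcol (N := N) m z') l'' w' * wΦ (N := M) κ l'' (x - w') =
      contourSumAdj L (HΦcol (N := N) m z') κ x := by
  obtain ⟨CH, -, hHb, hHs⟩ := Hcol_bdd_summable (N := N) (d := d)
  obtain ⟨CΦ, hΦ⟩ := exists_abs_wΦ_le (N := M) (d := d)
  obtain ⟨CΦN, -, hΦN⟩ := HΦcol_bdd (N := N) (d := d)
  have hcs : ∀ l, Summable (contourSum M (Hcol (N := N) m z') l) := fun l => summable_contourSum M (hHs m z') l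
  -- the left-hand side as a coarse 1-form, and its bound
  set ψ₁ : Form1 (d + 1) ℝ := fun κ x => ∑' w' : Fin (d + 1) → ℤ, ∑ l'' : Fin (d + 1),
    contourSum M (Hcol (N := N) m z') l'' w' * wΦ (N := M) κ l'' (x - w') with hψ₁def
  have hs1 : ∀ κ x, Summable (fun w' : Fin (d + 1) → ℤ => ∑ l'' : Fin (d + 1),
      contourSum M (Hcol (N := N) m z') l'' w' * wΦ (N := M) κ l'' (x - w')) :=
    fun κ x => summable_sum fun l'' _ => summable_mul_of_bdd' (hcs l'') (fun w' => hΦ κ l'' _)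
  have hs2 : Summable (fun w' : Fin (d + 1) → ℤ => ∑ l'' : Fin (d + 1), |contourSum M (Hcol (N := N) m z') l'' w'| * CΦ) :=
    summable_sum fun l'' _ => (hcs l'').abs.mul_right CΦ
  have hterm : ∀ κ x (w' : Fin (d + 1) → ℤ), |∑ l'' : Fin (d + 1), contourSum M (Hcol (N := N) m z') l'' w' * wΦ (N := M) κ l'' (x - w')| ≤
      ∑ l'' : Fin (d + 1), |contourSum M (Hcol (N := N) m z') l'' w'| * CΦ := fun κ x w' =>
    (Finset.abs_sum_le_sum_abs _ _).trans (Finset.sum_le_sum fun l'' _ => by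
      rw [abs_mul]; exact mul_le_mul_of_nonneg_left (hΦ κ l'' _) (abs_nonneg _))
  have hψ₁ : ∀ κ x, |ψ₁ κ x| ≤ ∑' w' : Fin (d + 1) → ℤ, ∑ l'' : Fin (d + 1), |contourSum M (Hcol (N := N) m z') l'' w'| * CΦ := by
    intro κ x
    rw [abs_le]
    constructor
    · rw [← tsum_neg]
      exact Summable.tsum_le_tsum (fun w' => (abs_le.mp (hterm κ x w')).1) hs2.neg (hs1 κ x)
    · exact Summable.tsum_le_tsum (fun w' => (abs_le.mp (hterm κ x w')).2) (hs1 κ x) hs2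
  have hψ₂ : ∀ κ x, |contourSumAdj L (HΦcol (N := N) m z') κ x| ≤ L * CΦN := fun κ x => abs_contourSumAdj_le (hΦN m z') κ x
  -- injectivity of 𝒬_Mᵀ reduces the claim to the fine identity
  suffices h : contourSumAdj M ψ₁ = contourSumAdj M (contourSumAdj L (HΦcol (N := N) m z')) by
    have := congrFun (congrFun (eq_of_contourSumAdj_eq (M := M) hψ₁ hψ₂ h) κ) x
    exact this
  rw [← contourSumAdj_mul M L (hΦN m z'), ← hN]
  funext μ y
  refine Eq.trans ?_ (hasSum_reproduction_EL hN m z' μ y).tsum_eq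
  rw [contourSumAdj_eq]
  have hsum : ∀ s : ℕ, Summable (fun w' : Fin (d + 1) → ℤ => ∑ l'' : Fin (d + 1),
      contourSum M (Hcol (N := N) m z') l'' w' * wΦ (N := M) μ l'' (quo M (y - (s : ℤ) • unitVec μ) - w')) :=
    fun s => hs1 μ _
  rw [← Summable.tsum_finsetSum (fun s _ => hsum s)]
  refine tsum_congr fun w' => ?_
  rw [Finset.sum_comm]
  refine Finset.sum_congr rfl fun l'' _ => ?_
  rw [contourSumAdj_eq, Finset.mul_sum]
  simp only [HΦcol_apply]

end StepIdentity

/-! ## §5 The field–multiplier block of the step residual vanishes -/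

section FM

variable {Lc : ℕ} [NeZero Lc]

/-- [folklore] `wVH d Lc j′ · ((Lc^{j′})^{d+2})⁻¹ = stepScale d Lc j′` (`M^{2(d+2)}·M^{−(d+2)} = M^{d+2}`). -/
theorem wVH_mul_inv (j' : ℕ) : wVH d Lc j' * (((Lc ^ j' : ℕ) : ℝ) ^ (d + 2))⁻¹ = stepScale d Lc j' := by
  unfold BalabanStepJetsSucc.wVH stepScale
  push_cast
  have hM : ((Lc : ℝ) ^ j') ^ (d + 2) ≠ 0 := pow_ne_zero _ (pow_ne_zero _ (by exact_mod_cast NeZero.ne Lc))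
  field_simp
  ring

/-- [folklore] The `(inr, inr)` block of `KInvStep Lc j′` at `Lc`-coarse points is the level-`Lc^{j′+1}` multiplier response. -/
theorem KInvStep_zsmul_zsmul_inr_inr (j' : ℕ) (l m : Fin (d + 1)) (y' q : Fin (d + 1) → ℤ) :
    KInvStep (d := d) Lc j' ((Lc : ℤ) • y') ((Lc : ℤ) • q) (Sum.inr l) (Sum.inr m) = wΦ (N := Lc ^ (j' + 1)) l m (y' - q) := by
  unfold OneStepKernelFamily.KInvStep
  rw [← BalabanStepJetsSucc.mmRead_eq_dec, BalabanStepJetsSucc.mmRead_inl_inl, zsmul_pow_succ, zsmul_pow_succ, KInv_inr_inr_coarse]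

/-- [folklore] **(J2)-fm: THE FIELD–MULTIPLIER BLOCK OF THE STEP RESIDUAL VANISHES**:
`(bhKStep (j+1) ∘ KInvStep Lc (j+1))(x, z, inl κ, inr m) = 0`. -/
theorem comp_bhKStep_KInvStep_inl_inr (j : ℕ) (x z : Fin (d + 1) → ℤ) (κ m : Fin (d + 1)) :
    comp (bhKStep d Lc (j + 1)) (KInvStep (d := d) Lc (j + 1)) x z (Sum.inl κ) (Sum.inr m) = 0 := by
  by_cases hz : Torus.proj Lc z = 0
  · obtain ⟨B, hB⟩ := exists_abs_KInvStep_le Lc (d := d) (j + 1)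
    obtain ⟨δ, C, hδ, hdec⟩ := decay_wΦ (N := Lc ^ (j + 1)) (d := d)
    have hX : Summable fun y => ∑ l : Fin (d + 1),
        wΦ (N := Lc ^ (j + 1)) κ l (x - y) * KInvStep (d := d) Lc (j + 1) y z (Sum.inl l) (Sum.inr m) :=
      summable_sum fun l _ => summable_mul_of_bdd'
        ((summable_of_decay510 hδ (hdec κ l)).comp_injective sub_right_injective) (fun y => hB _ _ _ _)
    rw [comp_bhKStep_succ_inl j _ x z κ (Sum.inr m) hX]
    have eK : ∀ (y : Fin (d + 1) → ℤ) (l : Fin (d + 1)), KInvStep (d := d) Lc (j + 1) y z (Sum.inl l) (Sum.inr m) =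
        (((Lc ^ (j + 1) : ℕ) : ℝ) ^ (d + 2))⁻¹ * contourSum (Lc ^ (j + 1)) (Hcol (N := Lc ^ (j + 1 + 1)) m (quo Lc z)) l y := by
      intro y l
      have h := congrFun (congrFun (fcol_KInvStep_inr_of_coarse (d := d) (j + 1) hz m) l) y
      rw [fcol_apply] at h
      exact h
    have eM : mcol Lc (KInvStep (d := d) Lc (j + 1)) z (Sum.inr m) = HΦcol (N := Lc ^ (j + 1 + 1)) m (quo Lc z) := by
      funext l y'
      rw [mcol_apply, HΦcol_apply]
      conv_lhs => rw [eq_zsmul_quo_of_proj hz]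
      exact KInvStep_zsmul_zsmul_inr_inr (j + 1) l m y' (quo Lc z)
    have e2 : ∀ y : Fin (d + 1) → ℤ, ∑ l : Fin (d + 1), wΦ (N := Lc ^ (j + 1)) κ l (x - y) * KInvStep (d := d) Lc (j + 1) y z (Sum.inl l) (Sum.inr m) =
        (((Lc ^ (j + 1) : ℕ) : ℝ) ^ (d + 2))⁻¹ * ∑ l : Fin (d + 1),
          contourSum (Lc ^ (j + 1)) (Hcol (N := Lc ^ (j + 1 + 1)) m (quo Lc z)) l y * wΦ (N := Lc ^ (j + 1)) κ l (x - y) := by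
      intro y
      rw [Finset.mul_sum]
      exact Finset.sum_congr rfl fun l _ => by rw [eK]; ring
    simp_rw [e2]
    rw [tsum_mul_left, eM, tsum_contourSum_Hcol_mul_wΦ (N := Lc ^ (j + 1 + 1)) (M := Lc ^ (j + 1)) (L := Lc) (pow_succ Lc (j + 1))
      m (quo Lc z) κ x, ← mul_assoc, wVH_mul_inv, sub_self]
  · unfold ExpKernelCalculus.comp
    have e : ∀ y, ∑ f : Fib d, bhKStep d Lc (j + 1) x y (Sum.inl κ) f * KInvStep (d := d) Lc (j + 1) y z f (Sum.inr m) = 0 :=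
      fun y => Finset.sum_eq_zero fun f _ => by rw [KInvStep_inr_off' (j + 1) hz y f m, mul_zero]
    simp_rw [e]
    exact tsum_zero

end FM

end

end Summit.QuantumFields.BalabanUV.Beta.BorderedHessian
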